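import Summits.KontsevichZagierPeriods.KontsevichZagierPeriods.Theorems.BetaCancellation.Negative.PiLink
import Literature.NumberTheory.Transcendental.SemialgebraicLineDeriv

/-!
# `ReflectionThird` (stmt-KontsevichZagierPeriods-12307) — the intermediate representations

Route `TerasomaMultiplication`, support item #9 `ReflectionThird`: Euler's reflection formula at
`a = 1/3` as a chain of Kontsevich–Zagier moves,
`[∫₀¹ sin(π/3) x^{-2/3} (1-x)^{-1/3} dx] ∼ [closed unit disc, 1]` (`sin(π/3)·B(1/3,2/3) = π`).

The chain (all moves of the fixed calculus `KZCalculus.lean`; `k = 3 sin(π/3) = 3√3/2`):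

* rule 2, `x = u³/(1+u³)`:            `[(0,1), sin(π/3) x^{-2/3}(1-x)^{-1/3}] ∼ [(0,∞), k/(1+u³)]`;
* rule 1 (domain), `(0,∞) = (0,1) ∪ [1,∞)`;
* rule 2, `v = 1/u` on `[1,∞)`:        `[[1,∞), k/(1+u³)] ∼ [(0,1], k v/(1+v³)]`, drop the null point;
* rule 1 (integrand), `1/(1+v³) + v/(1+v³) = 1/(v²-v+1)`:   `… ∼ [(0,1), k/(v²-v+1)]`;
* rule 2, `t = (2v-1)/√3`:             `… ∼ [{3t² < 1}, 3/(1+t²)]`;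
* rule 2, `T = (3t-t³)/(1-3t²)` (`tan 3θ`):   `… ∼ [ℝ, 1/(1+T²)]`;
* rule 2, `x = T/√(1+T²)`:             `… ∼ [(-1,1), 1/√(1-x²)] = invSqrtRep`;
* `invSqrtRep ∼ piRep` is in the tree (`Theorems/BetaCancellation/Negative/PiLink*.lean`,
  Kontsevich–Zagier's own §1.1 example).

This file builds the intermediate representations (domains, `ℚ`-semialgebraicity, absolute
integrability) and the substitution maps; the moves are in `…ReflectionThirdMoves(Two).lean`, the
first move and the assembly in `…ReflectionThird.lean`.

References: M. Kontsevich, D. Zagier, *Periods* (2001), §1.1–1.2; G. Andrews, R. Askey, R. Roy,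
*Special Functions* (1999), Thm. 1.2.1 and §1.2 (reflection via `∫₀^∞ u^{p-1}/(1+u^q) du`).
-/

noncomputable section

set_option linter.dupNamespace false

open MeasureTheory Set
open Literature.NumberTheory.Transcendental
open Literature.NumberTheory.Transcendental.KZ
open Literature.ModelTheory.ExponentialFields (IsSemialgebraic isSemialgebraic_univ)
open MvPolynomial (aeval X C)
open Literature.NumberTheory.Transcendental.KZreg (unitIoo isSemialgebraic_unitIoo)
open Summit.KontsevichZagierPeriods.KontsevichZagierPeriods.BetaCancellationNegative
  (symIoo isSemialgebraic_symIoo mem_symIoo integrableOn_symIoo_of_continuous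
    integrableOn_comp_apply_zero_iff integrableOn_unitIoo_of_continuous volume_setOf_apply_eq_zero)

namespace Summit.KontsevichZagierPeriods.KontsevichZagierPeriods.Theorems.ReflectionThird

/-! ### §0 The constant `k = 3√3/2 = 3 sin(π/3)` and semialgebraic atoms on `ℝ¹` -/

/-- The constant `k = 3√3/2 = 3·sin(π/3) = 3^{3/2}/2` carried along the chain. [folklore] -/
def k3 : ℝ := 3 * √3 / 2

/-- `0 < k`. [folklore] -/
theorem k3_pos : 0 < k3 := by
  have : 0 < √3 := Real.sqrt_pos.2 (by norm_num)
  unfold k3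
  positivity

/-- The coordinate `x ↦ x 0` is `ℚ`-semialgebraic on every `ℚ`-semialgebraic subset of `ℝ¹`.
[cite: BochnakCosteRoy1998, §2.2] -/
theorem isSemialgebraicFunOn_coord {s : Set (Fin 1 → ℝ)} (hs : IsSemialgebraic ℚ s) :
    IsSemialgebraicFunOn ℚ s (fun x => x 0) := by
  simpa using isSemialgebraicFunOn_aeval hs (X 0 : MvPolynomial (Fin 1) ℚ)

/-- The constant function `k = 3√3/2` is `ℚ`-semialgebraic (an algebraic constant).
[cite: BochnakCosteRoy1998, §2.2] -/
theorem isSemialgebraicFunOn_const_k3 {s : Set (Fin 1 → ℝ)} (hs : IsSemialgebraic ℚ s) :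
    IsSemialgebraicFunOn ℚ s (fun _ => k3) := by
  have h3 : IsSemialgebraicFunOn ℚ s (fun _ => (3:ℝ)) := isSemialgebraicFunOn_const_ofNat hs 3
  have h2 : IsSemialgebraicFunOn ℚ s (fun _ => (2:ℝ)) := isSemialgebraicFunOn_const_ofNat hs 2
  refine ((h3.fun_mul h3.fun_sqrt).fun_mul h2.fun_inv).congr fun x _ => ?_
  show 3 * √3 * 2⁻¹ = k3
  rw [k3, div_eq_mul_inv]

/-! ### §1 The domains -/

/-- `(0,∞) ⊆ ℝ¹`. [folklore] -/
def posDom : Set (Fin 1 → ℝ) := {x | 0 < x 0}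

/-- `[1,∞) ⊆ ℝ¹`. [folklore] -/
def iciDom : Set (Fin 1 → ℝ) := {x | 1 ≤ x 0}

/-- `(0,1] ⊆ ℝ¹`. [folklore] -/
def iocDom : Set (Fin 1 → ℝ) := {x | 0 < x 0 ∧ x 0 ≤ 1}

/-- `{t | 3t² < 1} = (-1/√3, 1/√3) ⊆ ℝ¹`. [folklore] -/
def jDom : Set (Fin 1 → ℝ) := {x | 3 * x 0 ^ 2 < 1}

/-- Membership in `posDom`. [folklore] -/
@[simp] theorem mem_posDom (x : Fin 1 → ℝ) : x ∈ posDom ↔ 0 < x 0 := Iff.rfl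

/-- Membership in `iciDom`. [folklore] -/
@[simp] theorem mem_iciDom (x : Fin 1 → ℝ) : x ∈ iciDom ↔ 1 ≤ x 0 := Iff.rfl

/-- Membership in `iocDom`. [folklore] -/
@[simp] theorem mem_iocDom (x : Fin 1 → ℝ) : x ∈ iocDom ↔ 0 < x 0 ∧ x 0 ≤ 1 := Iff.rfl

/-- Membership in `jDom`. [folklore] -/
@[simp] theorem mem_jDom (x : Fin 1 → ℝ) : x ∈ jDom ↔ 3 * x 0 ^ 2 < 1 := Iff.rfl

/-- Membership in `unitIoo`. [folklore] -/
theorem mem_unitIoo' (x : Fin 1 → ℝ) : x ∈ unitIoo ↔ 0 < x 0 ∧ x 0 < 1 := Iff.rfl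

/-- The item's spelling `{x | x 0 ∈ (0,1)}` of the unit interval is `unitIoo`. [folklore] -/
theorem setOf_mem_Ioo_eq_unitIoo : {x : Fin 1 → ℝ | x 0 ∈ Ioo (0:ℝ) 1} = unitIoo := by
  ext x
  simp

/-- `(0,∞)` is `ℚ`-semialgebraic. [folklore] -/
theorem isSemialgebraic_posDom : IsSemialgebraic ℚ posDom := by
  simpa [posDom] using Literature.ModelTheory.ExponentialFields.isSemialgebraic_setOf_eval_pos
    (k := ℚ) (R := ℝ) (X 0 : MvPolynomial (Fin 1) ℚ)

/-- `[1,∞)` is `ℚ`-semialgebraic. [folklore] -/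
theorem isSemialgebraic_iciDom : IsSemialgebraic ℚ iciDom := by
  simpa [iciDom] using Literature.ModelTheory.ExponentialFields.isSemialgebraic_setOf_eval_le
    (k := ℚ) (R := ℝ) (1 : MvPolynomial (Fin 1) ℚ) (X 0)

/-- `(0,1]` is `ℚ`-semialgebraic. [folklore] -/
theorem isSemialgebraic_iocDom : IsSemialgebraic ℚ iocDom := by
  have h1 := Literature.ModelTheory.ExponentialFields.isSemialgebraic_setOf_eval_pos
    (k := ℚ) (R := ℝ) (X 0 : MvPolynomial (Fin 1) ℚ)
  have h2 := Literature.ModelTheory.ExponentialFields.isSemialgebraic_setOf_eval_le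
    (k := ℚ) (R := ℝ) (X 0 : MvPolynomial (Fin 1) ℚ) 1
  convert h1.inter h2 using 1
  ext x
  simp [iocDom]

/-- `{3t² < 1}` is `ℚ`-semialgebraic. [folklore] -/
theorem isSemialgebraic_jDom : IsSemialgebraic ℚ jDom := by
  have h := Literature.ModelTheory.ExponentialFields.isSemialgebraic_setOf_eval_lt
    (k := ℚ) (R := ℝ) (3 * X 0 ^ 2 : MvPolynomial (Fin 1) ℚ) 1
  simp only [map_mul, map_pow, MvPolynomial.aeval_X, map_one, map_ofNat] at h
  exact h

/-- `{3t² < 1} ⊆ (-1,1)`. [folklore] -/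
theorem jDom_subset_symIoo : jDom ⊆ symIoo := by
  intro x hx
  simp only [mem_jDom] at hx
  simp only [mem_symIoo, mem_Ioo]
  constructor <;> nlinarith [sq_nonneg (x 0)]

/-- `(0,1) ⊆ (0,1]`. [folklore] -/
theorem unitIoo_subset_iocDom : unitIoo ⊆ iocDom := fun _ hx => ⟨hx.1, hx.2.le⟩

/-- `(0,1) ⊆ (0,∞)`. [folklore] -/
theorem unitIoo_subset_posDom : unitIoo ⊆ posDom := fun _ hx => hx.1

/-- `[1,∞) ⊆ (0,∞)`. [folklore] -/
theorem iciDom_subset_posDom : iciDom ⊆ posDom := fun x hx => by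
  simp only [mem_iciDom] at hx
  simp only [mem_posDom]
  linarith

/-! ### §2 Integrability transport `ℝ ↔ ℝ¹` -/

/-- Transport of integrability from `S ⊆ ℝ` to `{x | x 0 ∈ S} ⊆ ℝ¹`, for a domain given by an
extensionally equal set. [folklore] -/
theorem integrableOn_of_real {g : ℝ → ℝ} {S : Set ℝ} {D : Set (Fin 1 → ℝ)}
    (hD : ∀ x, x ∈ D ↔ x 0 ∈ S) (hg : IntegrableOn g S) :
    IntegrableOn (fun x : Fin 1 → ℝ => g (x 0)) D := by
  have hD' : D = {x | x 0 ∈ S} := Set.ext hD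
  rw [hD']
  exact integrableOn_comp_apply_zero_iff.2 hg

/-! ### §3 The representations -/

/-- `1 + u³ > 0` for `u > 0`. [folklore] -/
theorem one_add_cube_pos {u : ℝ} (hu : 0 < u) : 0 < 1 + u ^ 3 := by positivity

/-- `v² - v + 1 > 0`. [folklore] -/
theorem sq_sub_add_one_pos (v : ℝ) : 0 < v ^ 2 - v + 1 := by nlinarith [sq_nonneg (v - 1/2)]

/-- `k/(1+u³)` is integrable on `(0,∞)`: it is continuous and dominated by `2k/(1+u²)`.
[folklore] -/
theorem integrableOn_k3_div_one_add_cube :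
    IntegrableOn (fun u : ℝ => k3 / (1 + u ^ 3)) (Ioi 0) := by
  have hg : IntegrableOn (fun u : ℝ => 2 * k3 * (1 + u ^ 2)⁻¹) (Ioi 0) :=
    (integrable_inv_one_add_sq.const_mul (2 * k3)).integrableOn
  have hcont : ContinuousOn (fun u : ℝ => k3 / (1 + u ^ 3)) (Ioi 0) :=
    ContinuousOn.div continuousOn_const (by fun_prop) fun u hu => (one_add_cube_pos hu).ne'
  refine Integrable.mono' hg (hcont.aestronglyMeasurable measurableSet_Ioi) ?_
  refine (ae_restrict_iff' measurableSet_Ioi).2 (ae_of_all _ fun u hu => ?_)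
  have hu : 0 < u := hu
  have h3 : 0 < 1 + u ^ 3 := one_add_cube_pos hu
  have h2 : 0 < 1 + u ^ 2 := by positivity
  rw [Real.norm_eq_abs, abs_of_pos (div_pos k3_pos h3), div_le_iff₀ h3]
  rw [show 2 * k3 * (1 + u ^ 2)⁻¹ * (1 + u ^ 3) = k3 * ((2 + 2 * u ^ 3) / (1 + u ^ 2)) by
    field_simp]
  refine le_mul_of_one_le_right k3_pos.le ?_
  rw [le_div_iff₀ h2]
  nlinarith [sq_nonneg u, sq_nonneg (u - 1), mul_pos hu (sq_pos_of_pos hu)]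

/-- **`R = [(0,∞), k/(1+u³)]`**, the image of the Beta representation under `x = u³/(1+u³)`.
[cite: AndrewsAskeyRoy1999, §1.2] -/
def cubeRep : IntegralRep 1 where
  domain := posDom
  integrand := fun x => k3 / (1 + x 0 ^ 3)
  isSemialgebraic_domain := isSemialgebraic_posDom
  isSemialgebraicFunOn_integrand := by
    have hX := isSemialgebraicFunOn_coord isSemialgebraic_posDom
    have h1 : IsSemialgebraicFunOn ℚ posDom (fun _ => (1:ℝ)) := by
      simpa using isSemialgebraicFunOn_const_natCast isSemialgebraic_posDom 1
    refine ((isSemialgebraicFunOn_const_k3 isSemialgebraic_posDom).fun_mul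
      (h1.fun_add (hX.fun_pow 3)).fun_inv).congr fun x _ => ?_
    simp only [div_eq_mul_inv]
  integrableOn := integrableOn_of_real (g := fun u => k3 / (1 + u ^ 3)) (S := Ioi 0)
    (fun x => by simp [posDom]) integrableOn_k3_div_one_add_cube

/-- The domain of `cubeRep`. [folklore] -/
@[simp] theorem cubeRep_domain : cubeRep.domain = posDom := rfl

/-- The integrand of `cubeRep`. [folklore] -/
@[simp] theorem cubeRep_integrand : cubeRep.integrand = fun x => k3 / (1 + x 0 ^ 3) := rfl

/-- `R₁ = [(0,1), k/(1+u³)]`. [folklore] -/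
def cubeRepUnit : IntegralRep 1 :=
  cubeRep.restrict unitIoo isSemialgebraic_unitIoo unitIoo_subset_posDom

/-- `R₂ = [[1,∞), k/(1+u³)]`. [folklore] -/
def cubeRepIci : IntegralRep 1 :=
  cubeRep.restrict iciDom isSemialgebraic_iciDom iciDom_subset_posDom

/-- The domain of `cubeRepUnit`. [folklore] -/
@[simp] theorem cubeRepUnit_domain : cubeRepUnit.domain = unitIoo := rfl

/-- The integrand of `cubeRepUnit`. [folklore] -/
@[simp] theorem cubeRepUnit_integrand : cubeRepUnit.integrand = fun x => k3 / (1 + x 0 ^ 3) := rfl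

/-- The domain of `cubeRepIci`. [folklore] -/
@[simp] theorem cubeRepIci_domain : cubeRepIci.domain = iciDom := rfl

/-- The integrand of `cubeRepIci`. [folklore] -/
@[simp] theorem cubeRepIci_integrand : cubeRepIci.integrand = fun x => k3 / (1 + x 0 ^ 3) := rfl

/-- `k v/(1+v³)` is integrable on `(0,1]` (continuous on `[0,1]`). [folklore] -/
theorem integrableOn_k3_mul_div_one_add_cube :
    IntegrableOn (fun v : ℝ => k3 * v / (1 + v ^ 3)) (Ioc 0 1) := by
  have hcont : ContinuousOn (fun v : ℝ => k3 * v / (1 + v ^ 3)) (Icc 0 1) :=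
    ContinuousOn.div (by fun_prop) (by fun_prop) fun v hv => by
      have : 0 ≤ v := hv.1
      positivity
  exact (hcont.integrableOn_compact isCompact_Icc).mono_set Ioc_subset_Icc_self

/-- **`H' = [(0,1], k v/(1+v³)]`**, the image of `[[1,∞), k/(1+u³)]` under `v = 1/u`.
[cite: AndrewsAskeyRoy1999, §1.2] -/
def foldRep : IntegralRep 1 where
  domain := iocDom
  integrand := fun x => k3 * x 0 / (1 + x 0 ^ 3)
  isSemialgebraic_domain := isSemialgebraic_iocDom
  isSemialgebraicFunOn_integrand := by
    have hX := isSemialgebraicFunOn_coord isSemialgebraic_iocDom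
    have h1 : IsSemialgebraicFunOn ℚ iocDom (fun _ => (1:ℝ)) := by
      simpa using isSemialgebraicFunOn_const_natCast isSemialgebraic_iocDom 1
    refine (((isSemialgebraicFunOn_const_k3 isSemialgebraic_iocDom).fun_mul hX).fun_mul
      (h1.fun_add (hX.fun_pow 3)).fun_inv).congr fun x _ => ?_
    simp only [div_eq_mul_inv]
  integrableOn := integrableOn_of_real (g := fun v => k3 * v / (1 + v ^ 3)) (S := Ioc 0 1)
    (fun x => by simp [iocDom]) integrableOn_k3_mul_div_one_add_cube

/-- The domain of `foldRep`. [folklore] -/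
@[simp] theorem foldRep_domain : foldRep.domain = iocDom := rfl

/-- The integrand of `foldRep`. [folklore] -/
@[simp] theorem foldRep_integrand : foldRep.integrand = fun x => k3 * x 0 / (1 + x 0 ^ 3) := rfl

/-- `H = [(0,1), k v/(1+v³)]`. [folklore] -/
def foldRepUnit : IntegralRep 1 :=
  foldRep.restrict unitIoo isSemialgebraic_unitIoo unitIoo_subset_iocDom

/-- The domain of `foldRepUnit`. [folklore] -/
@[simp] theorem foldRepUnit_domain : foldRepUnit.domain = unitIoo := rfl

/-- The integrand of `foldRepUnit`. [folklore] -/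
@[simp] theorem foldRepUnit_integrand :
    foldRepUnit.integrand = fun x => k3 * x 0 / (1 + x 0 ^ 3) := rfl

/-- **`G = [(0,1), k/(v²-v+1)]`** (after partial fractions: `(1+v)/(1+v³) = 1/(v²-v+1)`).
[cite: AndrewsAskeyRoy1999, §1.2] -/
def quadRep : IntegralRep 1 where
  domain := unitIoo
  integrand := fun x => k3 / (x 0 ^ 2 - x 0 + 1)
  isSemialgebraic_domain := isSemialgebraic_unitIoo
  isSemialgebraicFunOn_integrand := by
    have hX := isSemialgebraicFunOn_coord isSemialgebraic_unitIoo
    have h1 : IsSemialgebraicFunOn ℚ unitIoo (fun _ => (1:ℝ)) := by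
      simpa using isSemialgebraicFunOn_const_natCast isSemialgebraic_unitIoo 1
    refine ((isSemialgebraicFunOn_const_k3 isSemialgebraic_unitIoo).fun_mul
      (((hX.fun_pow 2).fun_sub hX).fun_add h1).fun_inv).congr fun x _ => ?_
    simp only [div_eq_mul_inv]
  integrableOn := integrableOn_unitIoo_of_continuous
    (Continuous.div (by fun_prop) (by fun_prop) fun x => (sq_sub_add_one_pos (x 0)).ne')

/-- The domain of `quadRep`. [folklore] -/
@[simp] theorem quadRep_domain : quadRep.domain = unitIoo := rfl

/-- The integrand of `quadRep`. [folklore] -/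
@[simp] theorem quadRep_integrand : quadRep.integrand = fun x => k3 / (x 0 ^ 2 - x 0 + 1) := rfl

/-- **`J = [{3t² < 1}, 3/(1+t²)]`** (after `t = (2v-1)/√3`). [cite: AndrewsAskeyRoy1999, §1.2] -/
def arcRep : IntegralRep 1 where
  domain := jDom
  integrand := fun x => 3 / (1 + x 0 ^ 2)
  isSemialgebraic_domain := isSemialgebraic_jDom
  isSemialgebraicFunOn_integrand := by
    refine (isSemialgebraicFunOn_aeval_div_aeval isSemialgebraic_jDom (3 : MvPolynomial (Fin 1) ℚ)
      (1 + X 0 ^ 2) fun x _ => ?_).congr fun x _ => ?_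
    · simp only [map_add, map_one, map_pow, MvPolynomial.aeval_X]
      positivity
    · simp
  integrableOn := (integrableOn_symIoo_of_continuous
    (Continuous.div (by fun_prop) (by fun_prop) fun x => by positivity)).mono_set jDom_subset_symIoo

/-- The domain of `arcRep`. [folklore] -/
@[simp] theorem arcRep_domain : arcRep.domain = jDom := rfl

/-- The integrand of `arcRep`. [folklore] -/
@[simp] theorem arcRep_integrand : arcRep.integrand = fun x => 3 / (1 + x 0 ^ 2) := rfl

/-- **`L = [ℝ, 1/(1+T²)]`** (after the tripling map `T = (3t-t³)/(1-3t²)`).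
[cite: KontsevichZagier2001, §1.1] -/
def lineRep : IntegralRep 1 where
  domain := univ
  integrand := fun x => (1 + x 0 ^ 2)⁻¹
  isSemialgebraic_domain := isSemialgebraic_univ
  isSemialgebraicFunOn_integrand := by
    refine (isSemialgebraicFunOn_aeval_div_aeval isSemialgebraic_univ (1 : MvPolynomial (Fin 1) ℚ)
      (1 + X 0 ^ 2) fun x _ => ?_).congr fun x _ => ?_
    · simp only [map_add, map_one, map_pow, MvPolynomial.aeval_X]
      positivity
    · simp
  integrableOn := by
    have h := integrableOn_of_real (g := fun T => (1 + T ^ 2)⁻¹) (S := univ) (D := univ)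
      (fun x => by simp) integrable_inv_one_add_sq.integrableOn
    exact h

/-- The domain of `lineRep`. [folklore] -/
@[simp] theorem lineRep_domain : lineRep.domain = univ := rfl

/-- The integrand of `lineRep`. [folklore] -/
@[simp] theorem lineRep_integrand : lineRep.integrand = fun x => (1 + x 0 ^ 2)⁻¹ := rfl

/-! ### §4 The substitution maps of the rule-2 moves (functions on `ℝ` and on `ℝ¹`, derivatives) -/

/-- The substitution `u ↦ u³/(1+u³)`. [cite: AndrewsAskeyRoy1999, §1.2] -/
def cubeFun (u : ℝ) : ℝ := u ^ 3 / (1 + u ^ 3)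

/-- Its derivative `3u²/(1+u³)²`. [folklore] -/
def cubeFunDeriv (u : ℝ) : ℝ := 3 * u ^ 2 / (1 + u ^ 3) ^ 2

/-- The substitution on `ℝ¹`. [folklore] -/
def cubeMap (x : Fin 1 → ℝ) : Fin 1 → ℝ := fun _ => cubeFun (x 0)

/-- The derivative of `cubeMap`, `cubeFunDeriv • id`. [folklore] -/
def cubeMapDeriv (x : Fin 1 → ℝ) : (Fin 1 → ℝ) →L[ℝ] (Fin 1 → ℝ) :=
  cubeFunDeriv (x 0) • ContinuousLinearMap.id ℝ (Fin 1 → ℝ)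

/-- The inversion `u ↦ 1/u` of `ℝ¹`. [folklore] -/
def invMap (x : Fin 1 → ℝ) : Fin 1 → ℝ := fun _ => (x 0)⁻¹

/-- Its derivative `-(1/u²) • id`. [folklore] -/
def invMapDeriv (x : Fin 1 → ℝ) : (Fin 1 → ℝ) →L[ℝ] (Fin 1 → ℝ) :=
  (-(x 0 ^ 2)⁻¹) • ContinuousLinearMap.id ℝ (Fin 1 → ℝ)

/-- The affine map `v ↦ (2v-1)√3/3 = (2v-1)/√3` of `ℝ¹`. [folklore] -/
def affMap (x : Fin 1 → ℝ) : Fin 1 → ℝ := fun _ => (2 * x 0 - 1) * √3 / 3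

/-- Its derivative `(2√3/3) • id`. [folklore] -/
def affMapDeriv : (Fin 1 → ℝ) →L[ℝ] (Fin 1 → ℝ) := (2 * √3 / 3) • ContinuousLinearMap.id ℝ (Fin 1 → ℝ)

/-- The tripling map `t ↦ (3t-t³)/(1-3t²)` (`tan θ ↦ tan 3θ`). [folklore] -/
def trip (t : ℝ) : ℝ := (3 * t - t ^ 3) / (1 - 3 * t ^ 2)

/-- The tripling map on `ℝ¹`. [folklore] -/
def tripMap (x : Fin 1 → ℝ) : Fin 1 → ℝ := fun _ => trip (x 0)

/-- The derivative `3(1+t²)²/(1-3t²)²` of the tripling map. [folklore] -/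
def tripDeriv (t : ℝ) : ℝ := 3 * (1 + t ^ 2) ^ 2 / (1 - 3 * t ^ 2) ^ 2

/-- The derivative of `tripMap`, `tripDeriv • id`. [folklore] -/
def tripMapDeriv (x : Fin 1 → ℝ) : (Fin 1 → ℝ) →L[ℝ] (Fin 1 → ℝ) :=
  tripDeriv (x 0) • ContinuousLinearMap.id ℝ (Fin 1 → ℝ)

/-- The map `T ↦ T/√(1+T²)` (`tan θ ↦ sin θ`). [folklore] -/
def sinOfTan (T : ℝ) : ℝ := T / √(1 + T ^ 2)

/-- `sinOfTan` on `ℝ¹`. [folklore] -/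
def sinOfTanMap (x : Fin 1 → ℝ) : Fin 1 → ℝ := fun _ => sinOfTan (x 0)

/-- The derivative `1/((1+T²)√(1+T²))` of `sinOfTan`. [folklore] -/
def sinOfTanDeriv (T : ℝ) : ℝ := ((1 + T ^ 2) * √(1 + T ^ 2))⁻¹

/-- The derivative of `sinOfTanMap`. [folklore] -/
def sinOfTanMapDeriv (x : Fin 1 → ℝ) : (Fin 1 → ℝ) →L[ℝ] (Fin 1 → ℝ) :=
  sinOfTanDeriv (x 0) • ContinuousLinearMap.id ℝ (Fin 1 → ℝ)

end Summit.KontsevichZagierPeriods.KontsevichZagierPeriods.Theorems.ReflectionThird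

end
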